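import Mathlib
import Literature.Analysis.FluidPDE.CheskidovFriedlander2009.InviscidAttractor
import Literature.Analysis.FluidPDE.CheskidovFriedlander2009.InviscidEnergyEquality
import HarnessLib

/-!
# Cheskidov–Friedlander–Pavlović 2010, Theorem 4.3 and Corollary 4.6 PROVED: subcritical norms
# are locally integrable, and every solution blows up in `H^{5/6}` (Onsager's flexible side)

A. Cheskidov, S. Friedlander, N. Pavlović, *An inviscid dyadic model of turbulence: the global
attractor*, Discrete Contin. Dyn. Syst. 26 (2010) 781–794 = arXiv:math/0610815v1 (locators:
arXiv v1 PDF).  Discharges of the two remaining named facts of `InviscidBlowup.lean`: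

* `CheskidovFriedlanderPavlovic2010_thm43_holds` — **Thm. 4.3** p. 10: for a solution with
  non-negative `ℓ²` datum, `‖a(t)‖²_s` is locally integrable for every `s < 5/6`.  Printed proof:
  Thm. 4.2 gives "`|d(t)|²` is locally integrable" ((4.27)–(4.28); here `lintegral_dSeq_sq_le`,
  from `normSq_pert_le_dSeq` of `InviscidAttractor.lean` by monotone convergence:
  `θKq∫₀ᵀ|D|² ≤ |b(0)|²`), and (4.29)
  `Σ_j2^{2sj}b_j² ≤ Σ_j2^{2sj}λ^{1/3−2j/3}(j+1)(d_0²+⋯+d_j²) ≤ C_s|d|²` (`C_s < ∞` iff `s < 5/6`;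
  `hsNormSq_le_of_dSeq`), plus `‖a‖²_s ≤ 2‖b‖²_s + 2‖α⁰‖²_s` with `‖α⁰‖²_s < ∞` for `s < 5/6`.
* `CheskidovFriedlanderPavlovic2010_cor46_holds` — **Cor. 4.6** p. 11: for a solution with
  non-negative datum, `‖a(t)‖³_{5/6}` is not locally integrable on `[0,∞)`.  Printed proof
  (pp. 11–12): otherwise Thm. 4.5 (`CheskidovFriedlanderPavlovic2010_thm45_holds`,
  `InviscidEnergyEquality.lean`) gives the energy equality on every `[0,t]`, Thm. 4.4
  (`CheskidovFriedlanderPavlovic2010_thm44_holds`) gives `a₀(t) → α⁰₀ > 0` (4.40)–(4.41), so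
  `(f,a(t)) ≥ ½f₀α⁰₀` eventually (4.42) and `|a(t)|² ≥ c(t − T)` (4.43) — contradicting the
  convergence `a(t) → α⁰` in `ℓ²`.

With these two theorems every named fact of the Cheskidov–Friedlander 2009 /
Cheskidov–Friedlander–Pavlović 2010 cluster (`VanishingViscosityLimit.lean`, `InviscidBlowup.lean`)
is proved in the tree.  No new definitions, no new facts.

## References
* [CheskidovFriedlanderPavlovic2010] A. Cheskidov, S. Friedlander, N. Pavlović, An inviscid
  dyadic model of turbulence: the global attractor, DCDS 26 (2010) 781–794, Thm. 4.3 (4.29) p. 10,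
  Cor. 4.6 (4.40)–(4.43) pp. 11–12, Thm. 4.2 (4.27)–(4.28) pp. 9–10.
-/

noncomputable section

open Set Filter MeasureTheory Finset
open scoped Topology ENNReal

namespace Literature.Analysis.FluidPDE.CheskidovFriedlander2009

variable {f₀ : ℝ} {a : ℕ → ℝ → ℝ}

/-! ### Thm. 4.2, last clause: `|d(t)|²` is locally integrable -/

/-- **"`|d(t)|²` is locally integrable"** (Thm. 4.2, (4.27)–(4.28)), quantitatively and
scaling-covariantly: for a solution of the inviscid model (`λ = 2^{5/2}`, force `f₀ > 0`) with
non-negative datum and `T ≥ 0`, `∫₀ᵀ Σ_jD_j(τ)² dτ ≤ |b(0)|²/(θKq)` (`b = a − α⁰`,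
`D_j = λ^{1/6}d_j`), the time integral being the lower Lebesgue integral of the `[0,∞]`-valued sum.
[cite: CheskidovFriedlanderPavlovic2010, Thm 4.2 (4.27)–(4.28) p.9–10] -/
theorem lintegral_dSeq_sq_le (hf : 0 < f₀) (ha : IsSolution (5 / 2) 0 (force f₀) a)
    (h0 : ∀ j, 0 ≤ a j 0) {T : ℝ} (hT : 0 ≤ T) :
    ∫⁻ τ in Ioc (0 : ℝ) T, ∑' j, ENNReal.ofReal
        (dSeq CFP.s (fun i => a i τ - inviscidFixedPoint (5 / 2) f₀ i) j ^ 2) ≤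
      ENNReal.ofReal (normSq (fun j => a j 0 - inviscidFixedPoint (5 / 2) f₀ j)
        / (CFP.θ * (CFP.K f₀ * CFP.q))) := by
  set α : ℕ → ℝ := inviscidFixedPoint (5 / 2) f₀ with hαdef
  have hθKq : 0 < CFP.θ * (CFP.K f₀ * CFP.q) := mul_pos CFP.θ_pos (mul_pos (CFP.K_pos hf) CFP.q_pos)
  have hDc : ∀ j, ContinuousOn (fun τ => dSeq CFP.s (fun i => a i τ - α i) j ^ 2) (Icc 0 T) :=
    fun j => ((ha.continuousOn_dSeq CFP.s α j).pow 2).mono fun τ hτ => hτ.1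
  have hmeas : ∀ j, AEMeasurable (fun τ => ENNReal.ofReal (dSeq CFP.s (fun i => a i τ - α i) j ^ 2))
      (volume.restrict (Ioc 0 T)) := fun j =>
    (((hDc j).mono Ioc_subset_Icc_self).aemeasurable measurableSet_Ioc).ennreal_ofReal
  have hnbT : 0 ≤ normSq (fun j => a j T - α j) := tsum_nonneg fun j => sq_nonneg _
  rw [lintegral_tsum hmeas, ENNReal.tsum_eq_iSup_nat]
  refine iSup_le fun m => ?_
  cases m with
  | zero => simp
  | succ m =>
    rw [← lintegral_finsetSum' _ fun j _ => hmeas j]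
    have hPc : ContinuousOn (fun τ => ∑ j ∈ range (m + 1), dSeq CFP.s (fun i => a i τ - α i) j ^ 2)
        (Icc 0 T) := continuousOn_finsetSum _ fun j _ => hDc j
    have hint : IntegrableOn (fun τ => ∑ j ∈ range (m + 1), dSeq CFP.s (fun i => a i τ - α i) j ^ 2)
        (Ioc 0 T) := (hPc.integrableOn_compact isCompact_Icc).mono_set Ioc_subset_Icc_self
    have hnn : ∀ τ, 0 ≤ ∑ j ∈ range (m + 1), dSeq CFP.s (fun i => a i τ - α i) j ^ 2 :=
      fun τ => sum_nonneg fun j _ => sq_nonneg _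
    have heq : ∫⁻ τ in Ioc (0 : ℝ) T, ∑ j ∈ range (m + 1),
        ENNReal.ofReal (dSeq CFP.s (fun i => a i τ - α i) j ^ 2) =
        ENNReal.ofReal (∫ τ in (0 : ℝ)..T, ∑ j ∈ range (m + 1), dSeq CFP.s (fun i => a i τ - α i) j ^ 2) := by
      rw [intervalIntegral.integral_of_le hT, ofReal_integral_eq_lintegral_ofReal hint (ae_of_all _ hnn)]
      refine lintegral_congr fun τ => ?_
      rw [ENNReal.ofReal_sum_of_nonneg fun j _ => sq_nonneg _]
    rw [heq]
    refine ENNReal.ofReal_le_ofReal ?_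
    rw [le_div_iff₀ hθKq]
    have h := normSq_pert_le_dSeq hf ha h0 m le_rfl hT
    nlinarith

/-! ### Thm. 4.3: (4.29) and the subcritical integrability -/

/-- The weights against the fixed-point ratio: `2^{2sj}·q^{2j} = (2^{2s−5/3})^j`
(`λ^{2sj·(2/5)}λ^{−2j/3}` in the paper's notation, (4.29)). [cite: CheskidovFriedlanderPavlovic2010, Thm 4.3 (4.29) p.10] -/
theorem CFP.weight_mul_q_sq_pow (s : ℝ) (j : ℕ) :
    (2 : ℝ) ^ (2 * s * (j : ℝ)) * (CFP.q ^ 2) ^ j = ((2 : ℝ) ^ (2 * s - 5 / 3)) ^ j := by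
  rw [CFP.q, ← pow_mul, ← Real.rpow_natCast ((2 : ℝ) ^ (-(5 / 6) : ℝ)), ← Real.rpow_mul (by norm_num),
    ← Real.rpow_add two_pos, ← Real.rpow_natCast ((2 : ℝ) ^ (2 * s - 5 / 3)),
    ← Real.rpow_mul (by norm_num)]
  congr 1
  push_cast
  ring

/-- `ρ_s = 2^{2s−5/3} < 1` exactly when `s < 5/6` — the convergence condition of (4.29).
[cite: CheskidovFriedlanderPavlovic2010, Thm 4.3 (4.29) p.10] -/
theorem CFP.rho_lt_one {s : ℝ} (hs : s < 5 / 6) : (2 : ℝ) ^ (2 * s - 5 / 3) < 1 :=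
  Real.rpow_lt_one_of_one_lt_of_neg (by norm_num) (by linarith)

/-- **(4.29), pointwise, with the fixed point added back** (scaling-covariant): for `s < 5/6`,
`ρ = 2^{2s−5/3}`, every `u : ℕ → ℝ` and `b = u − α⁰`,
`‖u‖²_s ≤ (Σ_j2(j+1)ρ^j)·Σ_jD_j² + Σ_j2K²ρ^j` in `[0,∞]` — from `u_j² ≤ 2b_j² + 2α_j²`,
`b_j² ≤ (j+1)q^{2j}Σ_{l≤j}D_l²` (4.29) and `α_j = Kq^j`.
[cite: CheskidovFriedlanderPavlovic2010, Thm 4.3 (4.29) p.10] -/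
theorem hsNormSq_le_of_dSeq (f₀ : ℝ) {s : ℝ} (hs : s < 5 / 6) (u : ℕ → ℝ) :
    hsNormSq s u ≤
      ENNReal.ofReal (∑' j : ℕ, 2 * ((j : ℝ) + 1) * ((2 : ℝ) ^ (2 * s - 5 / 3)) ^ j) *
          (∑' j, ENNReal.ofReal (dSeq CFP.s (fun i => u i - inviscidFixedPoint (5 / 2) f₀ i) j ^ 2))
        + ENNReal.ofReal (∑' j : ℕ, 2 * CFP.K f₀ ^ 2 * ((2 : ℝ) ^ (2 * s - 5 / 3)) ^ j) := by
  set α : ℕ → ℝ := inviscidFixedPoint (5 / 2) f₀ with hαdef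
  set b : ℕ → ℝ := fun i => u i - α i with hb
  set ρ : ℝ := (2 : ℝ) ^ (2 * s - 5 / 3) with hρ
  have hρ0 : 0 ≤ ρ := (Real.rpow_pos_of_pos two_pos _).le
  have hρ1 : ρ < 1 := CFP.rho_lt_one hs
  have hαK : ∀ i, α i = CFP.K f₀ * CFP.q ^ i := CFP.inviscidFixedPoint_eq f₀
  have hsq := CFP.s_mul_q
  set D : ℝ≥0∞ := ∑' j, ENNReal.ofReal (dSeq CFP.s b j ^ 2) with hD
  -- summability of the two constant series
  have hρn : ‖ρ‖ < 1 := by rw [Real.norm_eq_abs, abs_of_nonneg hρ0]; exact hρ1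
  have hsumC : Summable fun j : ℕ => 2 * ((j : ℝ) + 1) * ρ ^ j := by
    have h1 := summable_pow_mul_geometric_of_norm_lt_one 1 hρn
    have h0 := summable_geometric_of_norm_lt_one hρn
    have : Summable fun j : ℕ => ((j : ℝ) + 1) * ρ ^ j := by
      simpa [pow_one, add_mul] using h1.add h0
    simpa [mul_assoc] using this.mul_left 2
  have hsumA : Summable fun j : ℕ => 2 * CFP.K f₀ ^ 2 * ρ ^ j :=
    (summable_geometric_of_norm_lt_one hρn).mul_left _
  have hCnn : ∀ j : ℕ, 0 ≤ 2 * ((j : ℝ) + 1) * ρ ^ j := fun j => by positivity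
  have hAnn : ∀ j : ℕ, 0 ≤ 2 * CFP.K f₀ ^ 2 * ρ ^ j := fun j => by positivity
  -- termwise bound
  have hterm : ∀ j : ℕ, ENNReal.ofReal ((2 : ℝ) ^ (2 * s * (j : ℝ)) * u j ^ 2) ≤
      ENNReal.ofReal (2 * ((j : ℝ) + 1) * ρ ^ j) * D + ENNReal.ofReal (2 * CFP.K f₀ ^ 2 * ρ ^ j) := by
    intro j
    have hw : 0 ≤ (2 : ℝ) ^ (2 * s * (j : ℝ)) := (Real.rpow_pos_of_pos two_pos _).le
    have hwq : (2 : ℝ) ^ (2 * s * (j : ℝ)) * (CFP.q ^ 2) ^ j = ρ ^ j := CFP.weight_mul_q_sq_pow s j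
    -- `u_j² ≤ 2b_j² + 2α_j²`, `b_j² ≤ (j+1)q^{2j}P_j`, `α_j² = K²q^{2j}`
    have hu : u j ^ 2 ≤ 2 * b j ^ 2 + 2 * α j ^ 2 := by
      have : u j = b j + α j := by simp [hb]
      rw [this]; nlinarith [sq_nonneg (b j - α j)]
    have hbj := sq_le_dSeq hsq b j
    have hαj : α j ^ 2 = CFP.K f₀ ^ 2 * (CFP.q ^ 2) ^ j := by rw [hαK]; ring
    set P : ℝ := ∑ l ∈ range (j + 1), dSeq CFP.s b l ^ 2 with hP
    have hP0 : 0 ≤ P := sum_nonneg fun l _ => sq_nonneg _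
    have hreal : (2 : ℝ) ^ (2 * s * (j : ℝ)) * u j ^ 2 ≤
        2 * ((j : ℝ) + 1) * ρ ^ j * P + 2 * CFP.K f₀ ^ 2 * ρ ^ j := by
      have h1 := mul_le_mul_of_nonneg_left hu hw
      have h2 := mul_le_mul_of_nonneg_left hbj hw
      rw [hαj] at h1
      have e1 : (2 : ℝ) ^ (2 * s * (j : ℝ)) * (((j : ℝ) + 1) * (CFP.q ^ 2) ^ j * P) =
          ((j : ℝ) + 1) * ρ ^ j * P := by rw [← hwq]; ring
      have e2 : (2 : ℝ) ^ (2 * s * (j : ℝ)) * (CFP.K f₀ ^ 2 * (CFP.q ^ 2) ^ j) =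
          CFP.K f₀ ^ 2 * ρ ^ j := by rw [← hwq]; ring
      nlinarith [h1, h2, e1, e2]
    -- `ofReal P ≤ D`
    have hPD : ENNReal.ofReal P ≤ D := by
      rw [hP, ENNReal.ofReal_sum_of_nonneg fun l _ => sq_nonneg _]
      exact ENNReal.sum_le_tsum _
    calc ENNReal.ofReal ((2 : ℝ) ^ (2 * s * (j : ℝ)) * u j ^ 2)
        ≤ ENNReal.ofReal (2 * ((j : ℝ) + 1) * ρ ^ j * P + 2 * CFP.K f₀ ^ 2 * ρ ^ j) :=
          ENNReal.ofReal_le_ofReal hreal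
      _ = ENNReal.ofReal (2 * ((j : ℝ) + 1) * ρ ^ j) * ENNReal.ofReal P
          + ENNReal.ofReal (2 * CFP.K f₀ ^ 2 * ρ ^ j) := by
          rw [ENNReal.ofReal_add (by positivity) (hAnn j), ENNReal.ofReal_mul (hCnn j)]
      _ ≤ ENNReal.ofReal (2 * ((j : ℝ) + 1) * ρ ^ j) * D + ENNReal.ofReal (2 * CFP.K f₀ ^ 2 * ρ ^ j) := by
          gcongr
  -- sum over `j`
  unfold hsNormSq
  calc ∑' j : ℕ, ENNReal.ofReal ((2 : ℝ) ^ (2 * s * ((j : ℕ) : ℝ)) * u j ^ 2)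
      ≤ ∑' j : ℕ, (ENNReal.ofReal (2 * ((j : ℝ) + 1) * ρ ^ j) * D
          + ENNReal.ofReal (2 * CFP.K f₀ ^ 2 * ρ ^ j)) := ENNReal.tsum_le_tsum hterm
    _ = (∑' j : ℕ, ENNReal.ofReal (2 * ((j : ℝ) + 1) * ρ ^ j)) * D
          + ∑' j : ℕ, ENNReal.ofReal (2 * CFP.K f₀ ^ 2 * ρ ^ j) := by
        rw [ENNReal.tsum_add, ENNReal.tsum_mul_right]
    _ = ENNReal.ofReal (∑' j : ℕ, 2 * ((j : ℝ) + 1) * ρ ^ j) * D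
          + ENNReal.ofReal (∑' j : ℕ, 2 * CFP.K f₀ ^ 2 * ρ ^ j) := by
        rw [ENNReal.ofReal_tsum_of_nonneg hCnn hsumC, ENNReal.ofReal_tsum_of_nonneg hAnn hsumA]

/-- **Cheskidov–Friedlander–Pavlović 2010, Theorem 4.3 — PROVED** (discharge of
`CheskidovFriedlanderPavlovic2010_thm43`): for every solution of the inviscid model (1.2)
(`λ = 2^{5/2}`, force `f₀ > 0`) with non-negative `ℓ²` datum, every `s < 5/6` and `T ≥ 0`,
`∫₀ᵀ‖a(t)‖²_s dt < ∞`.  Proof as printed: (4.29) + Thm. 4.2's local integrability of `|d|²`.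
[cite: CheskidovFriedlanderPavlovic2010, Thm 4.3 (4.29) p.10] -/
theorem CheskidovFriedlanderPavlovic2010_thm43_holds : CheskidovFriedlanderPavlovic2010_thm43 := by
  intro f₀ hf a ha h0 s hs T hT
  set α : ℕ → ℝ := inviscidFixedPoint (5 / 2) f₀ with hαdef
  set ρ : ℝ := (2 : ℝ) ^ (2 * s - 5 / 3) with hρ
  set C : ℝ≥0∞ := ENNReal.ofReal (∑' j : ℕ, 2 * ((j : ℝ) + 1) * ρ ^ j) with hC
  set A : ℝ≥0∞ := ENNReal.ofReal (∑' j : ℕ, 2 * CFP.K f₀ ^ 2 * ρ ^ j) with hA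
  set D : ℝ → ℝ≥0∞ := fun τ => ∑' j, ENNReal.ofReal (dSeq CFP.s (fun i => a i τ - α i) j ^ 2) with hD
  -- pointwise (4.29)
  have hpt : ∀ τ ∈ Icc (0 : ℝ) T, hsNormSq s (fun j => a j τ) ≤ C * D τ + A := fun τ _ =>
    hsNormSq_le_of_dSeq f₀ hs (fun j => a j τ)
  -- integrate over `[0,T]`
  have hDfin : ∫⁻ τ in Icc (0 : ℝ) T, D τ < ⊤ := by
    rw [← setLIntegral_congr Ioc_ae_eq_Icc]
    exact lt_of_le_of_lt (lintegral_dSeq_sq_le hf ha h0 hT) ENNReal.ofReal_lt_top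
  have hvol : volume (Icc (0 : ℝ) T) < ⊤ := by rw [Real.volume_Icc]; exact ENNReal.ofReal_lt_top
  calc ∫⁻ τ in Icc (0 : ℝ) T, hsNormSq s (fun j => a j τ)
      ≤ ∫⁻ τ in Icc (0 : ℝ) T, (C * D τ + A) := setLIntegral_mono' measurableSet_Icc hpt
    _ = C * (∫⁻ τ in Icc (0 : ℝ) T, D τ) + A * volume (Icc (0 : ℝ) T) := by
        rw [lintegral_add_right _ measurable_const,
          lintegral_const_mul' C _ (by rw [hC]; exact ENNReal.ofReal_ne_top), setLIntegral_const]
    _ < ⊤ := by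
        have hC' : C < ⊤ := by rw [hC]; exact ENNReal.ofReal_lt_top
        have hA' : A < ⊤ := by rw [hA]; exact ENNReal.ofReal_lt_top
        exact ENNReal.add_lt_top.2 ⟨ENNReal.mul_lt_top hC' hDfin, ENNReal.mul_lt_top hA' hvol⟩

/-! ### Cor. 4.6: blow-up in `H^{5/6}` -/

/-- `|u|² ≤ 2|u − α|² + 2|α|²` in `ℓ²`. [cite: CheskidovFriedlanderPavlovic2010, §2 (2.1) p.3] -/
theorem normSq_le_two_mul_pert {u α : ℕ → ℝ} (hu : Summable fun j => u j ^ 2)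
    (hα : Summable fun j => α j ^ 2) :
    normSq u ≤ 2 * normSq (fun j => u j - α j) + 2 * normSq α := by
  have h := normSq_sub_le (summable_sq_sub_of_sq hu hα) (hα.mul_left 1 |>.congr fun j => by ring :
    Summable fun j => (-α j) ^ 2)
  have e1 : (fun j => u j - α j - -α j) = u := by funext j; ring
  have e2 : normSq (fun j => -α j) = normSq α := by
    unfold normSq; exact tsum_congr fun j => by ring
  rw [e1, e2] at h
  exact h

/-- **Cheskidov–Friedlander–Pavlović 2010, Corollary 4.6 — PROVED** (discharge of
`CheskidovFriedlanderPavlovic2010_cor46`): for every solution of the inviscid model (1.2)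
(`λ = 2^{5/2}`, force `f₀ > 0`) with non-negative `ℓ²` datum there is `T > 0` with
`∫₀ᵀ‖a(t)‖³_{5/6}dt = ∞` — `‖a(t)‖³_{5/6}` is not locally integrable, "in particular `‖a(t)‖_{5/6}`
blows up in finite time".  Proof as printed (pp. 11–12): else Thm. 4.5 gives the energy equality
on every `[0,t]`, Thm. 4.4 gives `a₀(t) → α⁰₀ > 0`, so `|a(t)|² ≥ |a(0)|² + f₀α⁰₀(t − T)` for
large `t`, contradicting `a(t) → α⁰` in `ℓ²`.
[cite: CheskidovFriedlanderPavlovic2010, Cor 4.6 (4.40)–(4.43) p.11–12] -/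
theorem CheskidovFriedlanderPavlovic2010_cor46_holds : CheskidovFriedlanderPavlovic2010_cor46 := by
  intro f₀ hf a ha h0
  by_contra H
  push Not at H
  have hc0 : (5 / 2 : ℝ) ≠ 0 := by norm_num
  set α : ℕ → ℝ := inviscidFixedPoint (5 / 2) f₀ with hαdef
  have hαfix : IsFixedPoint (5 / 2) 0 (force f₀) α := CFP.isFixedPoint hf.le
  have hαsum : Summable fun j => α j ^ 2 := hαfix.1
  have hα0 : 0 < α 0 := inviscidFixedPoint_pos (5 / 2) hf 0
  -- Thm. 4.5: the energy equality on every `[0,t]`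
  have hE : ∀ t, 0 < t → normSq (fun j => a j t) = normSq (fun j => a j 0) + 2 * ∫ τ in (0 : ℝ)..t, f₀ * a 0 τ :=
    fun t ht => CheskidovFriedlanderPavlovic2010_thm45_holds f₀ hf a ha 0 t le_rfl ht.le
      (lt_top_iff_ne_top.2 (H t ht)) 0 t le_rfl ht.le le_rfl
  -- Thm. 4.4: `a(t) → α⁰`, hence `a₀(t) → α⁰₀` and `|a(t)|²` stays bounded
  obtain ⟨β, hβ, hatt⟩ := CheskidovFriedlanderPavlovic2010_thm44_holds
  set κ : ℝ := β * Real.sqrt ((2 : ℝ) ^ (5 / 6 : ℝ) * f₀) with hκdef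
  have hκ : 0 < κ := by
    have : 0 < (2 : ℝ) ^ (5 / 6 : ℝ) * f₀ := mul_pos (Real.rpow_pos_of_pos two_pos _) hf
    exact mul_pos hβ (Real.sqrt_pos.mpr this)
  set D₀ : ℝ := normSq (fun j => a j 0 - α j) with hD₀
  have hdec : ∀ t, 0 ≤ t → normSq (fun j => a j t - α j) ≤ D₀ * Real.exp (-(κ * t)) := by
    intro t ht
    have := hatt f₀ hf a ha h0 t ht
    simpa [hαdef, hκdef, hD₀, mul_assoc] using this
  have hmode := tendsto_mode_zero_of_exp_decay ha hαsum hκ hdec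
  have hD₀0 : 0 ≤ D₀ := tsum_nonneg fun j => sq_nonneg _
  have hbd : ∀ t, 0 ≤ t → normSq (fun j => a j t) ≤ 2 * D₀ + 2 * normSq α := by
    intro t ht
    have h1 := normSq_le_two_mul_pert (ha.summable_sq t ht) hαsum
    have h2 : normSq (fun j => a j t - α j) ≤ D₀ := by
      refine (hdec t ht).trans ?_
      have : Real.exp (-(κ * t)) ≤ 1 := Real.exp_le_one_iff.mpr (by nlinarith)
      nlinarith
    linarith
  -- (4.41)–(4.42): eventually `a₀(t) ≥ α⁰₀/2`
  obtain ⟨T₀, hT₀⟩ := eventually_atTop.1 (hmode.eventually_const_le (half_lt_self hα0))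
  set T₁ : ℝ := max T₀ 0 with hT₁
  have hT₁0 : 0 ≤ T₁ := le_max_right _ _
  have ha0ge : ∀ τ, T₁ ≤ τ → α 0 / 2 ≤ a 0 τ := fun τ hτ => hT₀ τ ((le_max_left _ _).trans hτ)
  -- (4.43): `∫₀ᵗ a₀ ≥ (α⁰₀/2)(t − T₁)` for `t ≥ T₁`
  have hcont := ha.continuousOn 0
  have hlow : ∀ t, T₁ ≤ t → α 0 / 2 * (t - T₁) ≤ ∫ τ in (0 : ℝ)..t, a 0 τ := by
    intro t ht
    have hi1 : IntervalIntegrable (a 0) volume 0 T₁ :=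
      (hcont.mono fun τ hτ => hτ.1).intervalIntegrable_of_Icc hT₁0
    have hi2 : IntervalIntegrable (a 0) volume T₁ t :=
      (hcont.mono fun τ hτ => hT₁0.trans hτ.1).intervalIntegrable_of_Icc ht
    rw [← intervalIntegral.integral_add_adjacent_intervals hi1 hi2]
    have h1 : 0 ≤ ∫ τ in (0 : ℝ)..T₁, a 0 τ :=
      intervalIntegral.integral_nonneg hT₁0 fun τ hτ => ha.nonneg hc0 hf.le h0 0 τ hτ.1
    have h2 : α 0 / 2 * (t - T₁) ≤ ∫ τ in T₁..t, a 0 τ := by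
      have h := intervalIntegral.integral_mono_on ht intervalIntegrable_const hi2
        fun τ hτ => ha0ge τ hτ.1
      rwa [intervalIntegral.integral_const, smul_eq_mul, mul_comm] at h
    linarith
  -- the contradiction at a large time
  set M : ℝ := 2 * D₀ + 2 * normSq α with hM
  have hM0 : 0 ≤ M := by have : 0 ≤ normSq α := tsum_nonneg fun j => sq_nonneg _; positivity
  have hL : 0 < f₀ * α 0 := mul_pos hf hα0
  set t : ℝ := T₁ + (M + 1) / (f₀ * α 0) with htdef
  have htT : T₁ ≤ t := by rw [htdef]; have := div_pos (by linarith : 0 < M + 1) hL; linarith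
  have ht0 : 0 < t := by rw [htdef]; have := div_pos (by linarith : 0 < M + 1) hL; linarith
  have h1 := hE t ht0
  have h2 := hbd t ht0.le
  have h3 := hlow t htT
  have h4 : 0 ≤ normSq (fun j => a j 0) := tsum_nonneg fun j => sq_nonneg _
  rw [intervalIntegral.integral_const_mul] at h1
  have h5 : f₀ * α 0 * (t - T₁) = M + 1 := by
    rw [htdef]; field_simp; ring
  nlinarith [mul_le_mul_of_nonneg_left h3 hf.le]

end Literature.Analysis.FluidPDE.CheskidovFriedlander2009

end
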